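import Literature.Analysis.InnerProduct.HigherLensSpaceSpectrum
import Literature.Combinatorics.Enumerative.AntidiagonalTupleCard
import Mathlib.RingTheory.PowerSeries.WellKnown
import HarnessLib

/-!
# The spectrum of a lens space of ANY dimension from the ONE-NORM of its congruence lattice (Lauret–Miatello–Rossetti):
# `dim P_k^G = ∑_{r ≤ k/2} C(r+n−1, n−1)·N_𝓛(k−2r)`, `F_L(z) = Θ_𝓛(z)/(1 − z²)^{n−1}`,
# `dim E_{k(k+2n−2)} = ∑_{r ≤ k/2} C(r+n−2, n−2)·N_𝓛(k−2r)`, and `L`, `L'` are isospectral iff `Θ_𝓛 = Θ_𝓛'`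

Layer `Literature/Analysis/InnerProduct`, namespace `Literature.Analysis.InnerProduct`; lane `lit-hodgefound` (Track 2 foundations
library), prover seat `lit-hodgefound-p06`, generation 47, self-proposed row g47-#1 — the sequel BY IMPORT of rows g44-#1/#2
(`HigherLensSpaceMultiplicity.lean`: `lensSpaceMonomialCount q p k = dim P_k^G`, `lensSpaceMultiplicity q p k = dim H_k^G =
dim E_{k(k+2n−2)}(L(q; p₁, …, p_n))` for a weight family `p : Fin n → ℤ`; `HigherLensSpaceSpectrum.lean`:
`lensSpaceMonomialCount_le_add_two`, `lensSpaceMultiplicity_add_two`, `mk_lensSpaceMultiplicity`) and the every-dimension version of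
row g43-#6 (`LensSpaceOneNormLattice.lean`, the three-dimensional case `n = 2` through Chebyshev characters). THEOREMS ONLY (no
definition, no instance, no notation, no named fact): the one-norm count `N_𝓛(k)` of the congruence lattice `𝓛 = 𝓛(q; p₁, …, p_n)`
is written in the statements as the cardinality of the finite set `{μ ∈ [−k, k]ⁿ : ∑ᵢ|μᵢ| = k ∧ q ∣ ∑ᵢ μᵢpᵢ}` (`Fintype.piFinset`
of `Finset.Icc` boxes, filtered; `|μᵢ|` is `Int.natAbs`, so `∑ᵢ|μᵢ| = k` is an equation in `ℕ`); `∑ᵢ|μᵢ| = k` forces `μ ∈ [−k, k]ⁿ`,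
so this IS `#{μ ∈ 𝓛 : ‖μ‖₁ = k}`. Everything holds for every modulus `q : ℕ` (for `q = 0` the "lattice" is `{∑ᵢμᵢpᵢ = 0}`) and
for arbitrary integer weights (lens spaces AND lens orbifolds), because the proofs are pure counting.

## Sources, verbatim

E. A. Lauret, R. J. Miatello, J. P. Rossetti, *Spectra of lens spaces from 1-norm spectra of congruence lattices*, IMRN 2016
(held text of the arXiv version `paper:arxiv-1311.7167`, whose numbering we quote; the survey below cites its isospectrality
criterion as "Theorem 3.6(i) in [LMR-onenorm]" in the printed numbering), §3: "**Definition 3.2.** Let `q ∈ ℕ` and `s = (s₁, …,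
s_m) ∈ ℤ^m` such that each entry `s_j` is coprime to `q`. We associate to the lens space `L(q; s)` the congruence lattice
`𝓛(q; s₁, …, s_m) = {(a₁, …, a_m) ∈ ℤ^m : a₁s₁ + ⋯ + a_ms_m ≡ 0 (mod q)}`. For `μ = (a₁, …, a_m) ∈ ℤ^m`, we set `‖μ‖₁ =
∑_{j=1}^m |a_j|`." (p0007); "**Lemma 3.6.** … `m_{π_{kε₁}}(μ) = C(r+m−2, m−2)` if `‖μ‖₁ = k − 2r` with `r ∈ ℕ₀`, `0` otherwise …
*Proof.* It is well known that the representation `π_{kε₁}` can be realized in the space of harmonic homogeneous polynomials `𝓗_k`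
of degree `k` in `m` variables. Moreover, `𝓟_k ≃ 𝓗_k ⊕ 𝓟_{k−2}` … thus `m_{π_{kε₁}}(μ) = m_{𝓟_k}(μ) − m_{𝓟_{k−2}}(μ)`. In order
to find the weights of `𝓟_k`, we set `f_j(x) = x_{2j−1} + ix_{2j}`, `f_{j+m} = x_{2j−1} − ix_{2j} ∈ 𝓟₁` for each `1 ≤ j ≤ m`. It
can be easily seen that the polynomials `f₁^{l₁}⋯f_{2m}^{l_{2m}}` with `∑_{j=1}^{2m} l_j = k` form a basis of `𝓟_k` given by
weight vectors. Indeed, `h ∈ T` acts on `f₁^{l₁}⋯f_{2m}^{l_{2m}}` by multiplication by `h^μ` where `μ = ∑_{j=1}^m (l_j −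
l_{j+m})ε_j`. It follows that `μ = ∑_j a_jε_j ∈ ℤ^m` is a weight of `𝓟_k` if and only if there are `l₁, …, l_{2m} ∈ ℕ₀` such
that `a_j = l_j − l_{j+m}` and `∑_{j=1}^{2m} l_j = k`. Furthermore, one checks that the last condition is equivalent to `k −
‖μ‖₁ = 2r` with `r ∈ ℕ₀`. Hence, `m_{𝓟_k}(μ)` equals the number of different ways one can write `r` as an ordered sum of `m`
different nonnegative integers, which equals `C(r+m−1, m−1)`." (p0008); "**Theorem 3.8.** Let `L = Γ\S^{2m−1}` be a lens space
with associated lattice `𝓛` … In the particular case when `p = 0` we have that `dim V^Γ_{π_{kε₁}} = ∑_{r=0}^{⌊k/2⌋} C(r+m−2, m−2)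
N_𝓛(k−2r)`. *Proof.* By Lemma 3.5 we have that `dim V^Γ_{π_{k,p}} = ∑_{μ ∈ 𝓛} m_{π_{k,p}}(μ)`. …" (p0009); "**Theorem 3.9.**
Let `L = Γ\S^{2m−1}` and `L' = Γ'\S^{2m−1}` be lens spaces with associated congruence lattices `𝓛` and `𝓛'` respectively. Then
(i) `L` and `L'` are `0`-isospectral if and only if `𝓛` and `𝓛'` are `‖·‖₁`-isospectral. … We shall prove by induction that
`N_𝓛(k) = N_𝓛'(k)` for every `k ∈ ℕ`. The case `k = 0` is clear, since both sides are equal to one. Suppose that [`N_𝓛(k) = N_𝓛'(k)`]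
holds for every `k < k₀`. By [Theorem 3.8, `p = 0`] we have that `∑_{r≥0} C(r+m−2, m−2)N_𝓛(k₀−2r) = ∑_{r≥0} C(r+m−2, m−2)N_𝓛'(k₀−2r)`. All the terms
with `r > 0` on both sides are equal by assumption, hence this equality implies that also `N_𝓛(k₀) = N_𝓛'(k₀)`." (p0010).
E. A. Lauret, R. J. Miatello, J. P. Rossetti, *Recent results on the spectra of lens spaces* (held text `paper:arxiv-1904.01146`),
§3 pp. 5–7: "It is straightforward to see that `(1 − z²)/((1 − ξ_q^{ls}z)(1 − ξ_q^{−ls}z)) = ∑_{m ∈ ℤ} ξ_q^{lms}z^{|m|}` for every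
`l, s ∈ ℤ`. … `N_𝓛(k) = #{μ = (a₁, …, a_n) ∈ 𝓛 : ‖μ‖₁ = |a₁| + ⋯ + |a_n| = k}`. We define the one-norm theta function of `𝓛` by
`Θ_𝓛(z) := ∑_{k≥0} N_𝓛(k)z^k`. Since `Θ_𝓛(z) = ∑_{μ ∈ 𝓛} z^{‖μ‖₁}`, we have thus proved **Theorem 3.1.** If `L` is a lens
orbifold and `𝓛` its associated congruence lattice, then we have that `F_L(z) = Θ_𝓛(z)/(1 − z²)^{n−1}`. … In other words,
the multiplicity of `λ_k = k(k+2n−2)` in `Spec(L)` is given by `dim 𝓗_k^Γ = ∑_{r=0}^{⌊k/2⌋} C(r+n−2, n−2)N_𝓛(k−2r)`, which is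
the expression in [LMR-onenorm]. … **Theorem 3.2** [LMR-onenorm]. Let `L` and `L'` be two lens spaces and let `𝓛` and `𝓛'` be
their corresponding congruence lattices. Then, `L` and `L'` are isospectral if and only if `𝓛` and `𝓛'` are `‖·‖₁`-isospectral
(i.e. `Θ_𝓛(z) = Θ_𝓛'(z)`)." Here `F_L(z) = ∑_k dim E_{k(k+2n−2)}z^k` is Ikeda's generating function (§2 of the survey; row g44-#2).

## The dictionary and the proof, as formalised

LMR's weight vectors `f₁^{l₁}⋯f_{2m}^{l_{2m}}` are Ikeda–Yamamoto's monomials `z^Iz̄^J` (`I_j = l_j`, `J_j = l_{j+m}`), counted by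
the tree's `lensSpaceMonomialCount q p k` (`dim 𝓟_k^Γ`) through the degrees `xᵢ = Iᵢ + Jᵢ` (`∑xᵢ = k`, `x ∈ antidiagonalTuple`)
and the splittings `(Iᵢ, Jᵢ) ∈ antidiagonal xᵢ`, with the invariance condition `q ∣ ∑ᵢ(Iᵢ − Jᵢ)pᵢ`; LMR's weight is the
charge vector `μ = I − J`, and "`k − ‖μ‖₁ = 2r`, … the number of different ways one can write `r` as an ordered sum of `m`
nonnegative integers" is the bijection `(I, J) ↦ (μ = I − J, r = min(I, J))` (coordinatewise; inverse `(μ, r) ↦ (r + μ⁺, r +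
μ⁻)`, `Iᵢ + Jᵢ = |μᵢ| + 2rᵢ`), under which the invariant monomials of degree `k` correspond to the pairs `(r, μ)` with `∑rᵢ = j
≤ k/2`, `μ ∈ 𝓛`, `‖μ‖₁ = k − 2j` (§1, `Finset.card_bij'`); the number of `r` with `∑rᵢ = j` is `#antidiagonalTuple m j = C(j+m−1,
m−1)` (the tree's `Literature.Combinatorics.Enumerative.card_antidiagonalTuple_succ`). Summing Lemma 3.6 over `𝓛` as in the
proof of Theorem 3.8
gives `dim 𝓟_k^Γ = ∑_{j ≤ k/2} C(j+m−1, m−1)N_𝓛(k−2j)`, i.e. `∑_k dim 𝓟_k^Γ z^k = Θ_𝓛(z)·∑_j C(j+m−1, m−1)z^{2j} = Θ_𝓛(z)/(1 −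
z²)^m` (§2: `(1 − z²)^m·∑_j C(j+m−1, m−1)z^{2j} = 1` by Pascal's rule and induction on `m`), hence — with `dim 𝓗_k^Γ = dim 𝓟_k^Γ −
dim 𝓟_{k−2}^Γ`, i.e. `F_L = (1 − z²)∑_k dim 𝓟_k^Γ z^k` — THEOREM 3.1 `(1 − z²)^{m−1}F_L = Θ_𝓛`, Theorem 3.8 (`p = 0`), and THEOREM 3.9 (i) /
3.2 by cancelling the non-zero-divisor `(1 − z²)^{m−1}` of `ℤ⟦z⟧` (equivalent to the printed induction on `k`). Deviation from the
survey's road: its character/Molien step `(1 − z²)/((1 − ξz)(1 − ξ⁻¹z)) = ∑_m ξ^m z^{|m|}` followed by the orthogonality of the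
characters of `ℤ/q` is replaced by the direct monomial count of LMR's own Lemma 3.6 (its combinatorial content is the same
bijection), which is why no hypothesis `q ≠ 0` and no coprimality is needed; §4 recovers the survey's displayed computation before Theorem 3.1 in `ℝ⟦z⟧`
from the tree's `mk_lensSpaceMultiplicity`. With the tree's indexing a weight family `p : Fin (d+1) → ℤ` has `m = d + 1` entries
(`L = S^{2d+1}/G`), so `C(r+m−1, m−1) = C(r+d, d)` and `(1 − z²)^{m−1} = (1 − z²)^d`.

## What is proved

* §1 **`lensSpaceMonomialCount_eq_sum_card_antidiagonalTuple_mul`** (every `n`: `dim 𝓟_k^Γ = ∑_{j ≤ k/2} #antidiagonalTuple n j ·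
  N_𝓛(k−2j)`), **`lensSpaceMonomialCount_eq_sum_choose_mul`** (LEMMA 3.6 summed over `𝓛`: `dim 𝓟_k^Γ = ∑_{j ≤ k/2} C(j+d, d)N_𝓛(k−2j)`).
* §2 (any commutative ring of coefficients) `one_sub_X_sq_pow_mul_mk_even_choose` (`(1 − z²)^{d+1}·∑_j C(j+d,d)z^{2j} = 1`),
  **`mk_lensSpaceMonomialCount_eq_mul`** (`∑_k dim 𝓟_k^Γ z^k = (∑_j C(j+d,d)z^{2j})·Θ_𝓛`), **`one_sub_X_sq_pow_mul_mk_lensSpaceMonomialCount`**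
  (`(1 − z²)^{d+1}·∑_k dim 𝓟_k^Γ z^k = Θ_𝓛`), `mk_lensSpaceMultiplicity_eq_one_sub_X_sq_mul`, **`one_sub_X_sq_pow_mul_mk_lensSpaceMultiplicity`**
  (THEOREM 3.1: `(1 − z²)^d·F_L(z) = Θ_𝓛(z)`), **`lensSpaceMultiplicity_eq_sum_choose_mul`** (THEOREM 3.8 (`p = 0`) / the survey's multiplicity formula after Theorem 3.1:
  `dim E_{k(k+2d+2)}(L(q; p₀, …, p_{d+1})) = ∑_{j ≤ k/2} C(j+d, d)N_𝓛(k−2j)`), `lensSpaceMultiplicity_fin_one` (one weight: `dim H_k^Γ = N_𝓛(k)`).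
* §3 **`lensSpaceMultiplicity_eq_iff_card_oneNorm_congruenceLattice_eq`** (THEOREM 3.9 (i) / 3.2: same multiplicities for all `k` iff
  same one-norm counts for all `k`, for `L(q; p)`, `L(q'; p')` of the same dimension).
* §4 `sum_range_one_sub_X_sq_pow_mul_inv_prod_quadratic` (the survey's computation before Theorem 3.1: `∑_{l<q}(1 − z²)^{d+1}/∏ᵢ(1 − 2cos(2πlpᵢ/q)z + z²)
  = q·Θ_𝓛(z)` in `ℝ⟦z⟧`).
* §5 values: `card_oneNorm_congruenceLattice_zero` (`N_𝓛(0) = 1`), `card_oneNorm_congruenceLattice_one` (`N_𝓛(1) = 0` for a lens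
  space), and `q = 1`: **`mk_card_oneNorm_int_mul_one_sub_X_pow`** (`Θ_{ℤ^{d+1}}(z)·(1 − z)^{d+1} = (1 + z)^{d+1}`, the one-norm
  spheres of `ℤ^{d+1}`, from `dim 𝓟_k(ℂ^{d+1}) = C(k+2d+1, 2d+1)`).

## References

* [LauretMiatelloRossetti2015] E. A. Lauret, R. J. Miatello, J. P. Rossetti, *Spectra of lens spaces from 1-norm spectra of
  congruence lattices*, Int. Math. Res. Not. IMRN 2016 (4) 1054–1089 (arXiv:1311.7167: Definition 3.2, Lemma 3.6, Theorem 3.8,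
  Theorem 3.9 (i); printed numbering: Theorem 3.6 (i) for the isospectrality criterion).
* [LauretMiatelloRossetti2019] E. A. Lauret, R. J. Miatello, J. P. Rossetti, *Recent results on the spectra of lens spaces*, São
  Paulo J. Math. Sci. 15 (2019) 240–267, §3 pp. 5–7 (the computation before Theorem 3.1, the multiplicity formula after it),
  Theorems 3.1, 3.2.
* [IkedaYamamoto1979] A. Ikeda, Y. Yamamoto, *On the spectra of 3-dimensional lens spaces*, Osaka J. Math. 16 (1979) 447–469, §3
  (3.2)–(3.3) (the monomial basis `z^Iz̄^J`).
-/

noncomputable section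

open Finset PowerSeries

namespace Literature.Analysis.InnerProduct

/-! ### §1 Lemma 3.6 summed over the lattice: `dim 𝓟_k^Γ = ∑_{j ≤ k/2} C(j+m−1, m−1)·N_𝓛(k − 2j)` by the bijection
### `z^Iz̄^J ↦ (μ = I − J, r = min(I, J))` -/

/-- **The weight count of `𝓟_k`, summed over the congruence lattice, in every dimension `n`**: the number of `G`-invariant monomials
`z^Iz̄^J` of degree `k` on `ℂⁿ` (`dim 𝓟_k^Γ = lensSpaceMonomialCount q p k`) equals `∑_{j ≤ k/2} #{r ∈ ℕⁿ : ∑rᵢ = j}·N_𝓛(k − 2j)`,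
`N_𝓛(s) = #{μ ∈ ℤⁿ : ‖μ‖₁ = s, q ∣ ∑μᵢpᵢ}` — the bijection `(I, J) ↦ (μ, r) = (I − J, min(I, J))` ("`μ = ∑_j a_jε_j` is a weight of
`𝓟_k` if and only if there are `l₁, …, l_{2m} ∈ ℕ₀` such that `a_j = l_j − l_{j+m}` and `∑l_j = k` … equivalent to `k − ‖μ‖₁ = 2r`
… `m_{𝓟_k}(μ)` equals the number of different ways one can write `r` as an ordered sum of `m` different nonnegative integers").
[cite: LauretMiatelloRossetti2015, Lemma 3.6 (proof) and Theorem 3.8 (proof)] -/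
theorem lensSpaceMonomialCount_eq_sum_card_antidiagonalTuple_mul (q : ℕ) {n : ℕ} (p : Fin n → ℤ) (k : ℕ) :
    lensSpaceMonomialCount q p k = ∑ j ∈ range (k / 2 + 1), (Finset.Nat.antidiagonalTuple n j).card *
      ((Fintype.piFinset fun _ : Fin n ↦ Finset.Icc (-((k - 2 * j : ℕ) : ℤ)) ((k - 2 * j : ℕ) : ℤ)).filter
        (fun μ ↦ ∑ i, (μ i).natAbs = k - 2 * j ∧ (q : ℤ) ∣ ∑ i, μ i * p i)).card := by
  classical
  -- the one-norm shells of the congruence lattice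
  set N : ℕ → Finset (Fin n → ℤ) := fun s ↦
    (Fintype.piFinset fun _ : Fin n ↦ Finset.Icc (-(s : ℤ)) (s : ℤ)).filter
      (fun μ ↦ ∑ i, (μ i).natAbs = s ∧ (q : ℤ) ∣ ∑ i, μ i * p i) with hN
  -- the invariant monomials of degree `k`, as pairs `(x, e)` (degrees and splittings)
  set S : Finset (Σ _ : Fin n → ℕ, Fin n → ℕ × ℕ) :=
    (Finset.Nat.antidiagonalTuple n k).sigma fun x ↦
      (Fintype.piFinset (fun i ↦ antidiagonal (x i))).filter
        (fun e ↦ (q : ℤ) ∣ ∑ i, (((e i).1 : ℤ) - (e i).2) * p i) with hS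
  -- the pairs `(r, μ)` with `∑rᵢ = j ≤ k/2`, `μ ∈ 𝓛`, `‖μ‖₁ = k − 2j`
  set T : Finset (Σ _ : ℕ, (Fin n → ℕ) × (Fin n → ℤ)) :=
    (range (k / 2 + 1)).sigma fun j ↦ Finset.Nat.antidiagonalTuple n j ×ˢ N (k - 2 * j) with hT
  have hcount : lensSpaceMonomialCount q p k = S.card := by
    rw [hS, Finset.card_sigma]
    unfold lensSpaceMonomialCount
    refine Finset.sum_congr rfl fun x _ ↦ ?_
    rw [Finset.card_filter]
  have hTcard : T.card = ∑ j ∈ range (k / 2 + 1), (Finset.Nat.antidiagonalTuple n j).card * (N (k - 2 * j)).card := by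
    rw [hT, Finset.card_sigma]
    simp only [Finset.card_product]
  rw [hcount, show (∑ j ∈ range (k / 2 + 1), (Finset.Nat.antidiagonalTuple n j).card *
      ((Fintype.piFinset fun _ : Fin n ↦ Finset.Icc (-((k - 2 * j : ℕ) : ℤ)) ((k - 2 * j : ℕ) : ℤ)).filter
        (fun μ ↦ ∑ i, (μ i).natAbs = k - 2 * j ∧ (q : ℤ) ∣ ∑ i, μ i * p i)).card) = T.card by rw [hTcard]]
  refine Finset.card_bij'
    (fun xe _ ↦ ⟨∑ i, min (xe.2 i).1 (xe.2 i).2,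
      (fun i ↦ min (xe.2 i).1 (xe.2 i).2, fun i ↦ ((xe.2 i).1 : ℤ) - (xe.2 i).2)⟩)
    (fun t _ ↦ ⟨fun i ↦ 2 * t.2.1 i + (t.2.2 i).natAbs,
      fun i ↦ (t.2.1 i + (t.2.2 i).toNat, t.2.1 i + (-t.2.2 i).toNat)⟩)
    ?_ ?_ ?_ ?_
  · -- `(x, e) ↦ (j, r, μ)` lands in `T`
    rintro ⟨x, e⟩ hxe
    simp only [hS, Finset.mem_sigma, Finset.mem_filter, Fintype.mem_piFinset, Finset.Nat.mem_antidiagonalTuple,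
      HasAntidiagonal.mem_antidiagonal] at hxe
    obtain ⟨hx, he, hdvd⟩ := hxe
    have hsum : ∑ i, ((((e i).1 : ℤ) - (e i).2).natAbs + 2 * min (e i).1 (e i).2) = k := by
      rw [← hx]
      exact Finset.sum_congr rfl fun i _ ↦ by have := he i; omega
    rw [Finset.sum_add_distrib, ← Finset.mul_sum] at hsum
    simp only [hT, hN, Finset.mem_sigma, Finset.mem_range, Finset.mem_product, Finset.Nat.mem_antidiagonalTuple,
      Finset.mem_filter, Fintype.mem_piFinset, Finset.mem_Icc]
    refine ⟨by omega, trivial, fun i ↦ ?_, by omega, hdvd⟩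
    have hi : (((e i).1 : ℤ) - (e i).2).natAbs ≤ ∑ i, (((e i).1 : ℤ) - (e i).2).natAbs :=
      Finset.single_le_sum (f := fun i ↦ (((e i).1 : ℤ) - (e i).2).natAbs) (fun i _ ↦ Nat.zero_le _) (Finset.mem_univ i)
    omega
  · -- `(j, r, μ) ↦ (x, e)` lands in `S`
    rintro ⟨j, r, μ⟩ ht
    simp only [hT, hN, Finset.mem_sigma, Finset.mem_range, Finset.mem_product, Finset.Nat.mem_antidiagonalTuple,
      Finset.mem_filter, Fintype.mem_piFinset, Finset.mem_Icc] at ht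
    obtain ⟨hj, hr, -, hμ, hdvd⟩ := ht
    simp only [hS, Finset.mem_sigma, Finset.mem_filter, Fintype.mem_piFinset, Finset.Nat.mem_antidiagonalTuple,
      HasAntidiagonal.mem_antidiagonal]
    refine ⟨?_, fun i ↦ by omega, ?_⟩
    · rw [Finset.sum_add_distrib, ← Finset.mul_sum, hr, hμ]
      omega
    · have hterm : ∀ i, (((r i + (μ i).toNat : ℕ) : ℤ) - ((r i + (-μ i).toNat : ℕ) : ℤ)) * p i = μ i * p i := by
        intro i
        congr 1
        push_cast
        omega
      simp only [hterm]
      exact hdvd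
  · -- left inverse
    rintro ⟨x, e⟩ hxe
    simp only [hS, Finset.mem_sigma, Finset.mem_filter, Fintype.mem_piFinset, Finset.Nat.mem_antidiagonalTuple,
      HasAntidiagonal.mem_antidiagonal] at hxe
    obtain ⟨-, he, -⟩ := hxe
    simp only [Sigma.mk.injEq]
    refine ⟨funext fun i ↦ by have := he i; omega, ?_⟩
    rw [heq_eq_eq]
    funext i
    exact Prod.ext (by simp only; omega) (by simp only; omega)
  · -- right inverse
    rintro ⟨j, r, μ⟩ ht
    simp only [hT, hN, Finset.mem_sigma, Finset.mem_range, Finset.mem_product, Finset.Nat.mem_antidiagonalTuple,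
      Finset.mem_filter, Fintype.mem_piFinset, Finset.mem_Icc] at ht
    obtain ⟨-, hr, -, -, -⟩ := ht
    have hmin : ∀ i, min (r i + (μ i).toNat) (r i + (-μ i).toNat) = r i := fun i ↦ by omega
    simp only [Sigma.mk.injEq, hmin]
    refine ⟨hr, ?_⟩
    rw [heq_eq_eq, Prod.mk.injEq]
    exact ⟨rfl, funext fun i ↦ by push_cast; omega⟩

/-- **LEMMA 3.6 SUMMED OVER THE LATTICE (the proof of Theorem 3.8 at the level of `𝓟_k`): `dim 𝓟_k^Γ = ∑_{j ≤ k/2} C(j+d, d)·N_𝓛(k −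
2j)`** for `L(q; p₀, …, p_d) = S^{2d+1}/G` (`m = d + 1` weights; "`m_{𝓟_k}(μ) = C(r+m−1, m−1)` if `r = ½(k − ‖μ‖₁) ∈ ℕ₀`, `0`
otherwise", and `dim 𝓟_k^Γ = ∑_{μ ∈ 𝓛} m_{𝓟_k}(μ)`). [cite: LauretMiatelloRossetti2015, Lemma 3.6 and Theorem 3.8 (proof)] -/
theorem lensSpaceMonomialCount_eq_sum_choose_mul (q : ℕ) {d : ℕ} (p : Fin (d + 1) → ℤ) (k : ℕ) :
    lensSpaceMonomialCount q p k = ∑ j ∈ range (k / 2 + 1), (j + d).choose d *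
      ((Fintype.piFinset fun _ : Fin (d + 1) ↦ Finset.Icc (-((k - 2 * j : ℕ) : ℤ)) ((k - 2 * j : ℕ) : ℤ)).filter
        (fun μ ↦ ∑ i, (μ i).natAbs = k - 2 * j ∧ (q : ℤ) ∣ ∑ i, μ i * p i)).card := by
  rw [lensSpaceMonomialCount_eq_sum_card_antidiagonalTuple_mul]
  simp_rw [Literature.Combinatorics.Enumerative.card_antidiagonalTuple_succ]

/-! ### §2 Generating functions: `∑_k dim 𝓟_k^Γ z^k = Θ_𝓛(z)/(1 − z²)^m` and THEOREM 3.1 `F_L(z) = Θ_𝓛(z)/(1 − z²)^{m−1}` -/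

/-- The `z^k`-coefficient of `(∑_j g_j z^{2j})·(∑_s f_s z^s)` is `∑_{j ≤ k/2} g_j f_{k−2j}`. [folklore] -/
private theorem coeff_mk_even_mul_mk {R : Type*} [CommSemiring R] (g f : ℕ → R) (k : ℕ) :
    coeff k (PowerSeries.mk (fun m ↦ if 2 ∣ m then g (m / 2) else 0) * PowerSeries.mk f) =
      ∑ j ∈ range (k / 2 + 1), g j * f (k - 2 * j) := by
  rw [coeff_mul, Finset.Nat.sum_antidiagonal_eq_sum_range_succ (fun b a ↦ coeff b (PowerSeries.mk _) * coeff a (PowerSeries.mk f)) k]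
  simp only [coeff_mk, ite_mul, zero_mul]
  rw [← Finset.sum_filter]
  refine Finset.sum_nbij' (fun b ↦ b / 2) (fun j ↦ 2 * j) (fun b hb ↦ ?_) (fun j hj ↦ ?_) (fun b hb ↦ ?_) (fun j _ ↦ ?_)
    (fun b hb ↦ ?_)
  · simp only [Finset.mem_filter, Finset.mem_range] at hb
    simp only [Finset.mem_range]
    omega
  · simp only [Finset.mem_range] at hj
    simp only [Finset.mem_filter, Finset.mem_range]
    omega
  · simp only [Finset.mem_filter, Finset.mem_range] at hb
    omega
  · omega
  · simp only [Finset.mem_filter, Finset.mem_range] at hb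
    rw [Nat.mul_div_cancel' hb.2]

/-- `(1 − z²)·∑_r z^{2r} = 1`. [folklore] -/
private theorem one_sub_X_sq_mul_mk_even_one (R : Type*) [CommRing R] :
    ((1 : R⟦X⟧) - X ^ 2) * PowerSeries.mk (fun m ↦ if 2 ∣ m then (1 : R) else 0) = 1 := by
  ext m
  rw [sub_mul, one_mul, map_sub, coeff_X_pow_mul', coeff_mk, coeff_one]
  rcases m with _ | _ | m
  · simp
  · norm_num
  · rw [if_pos (show 2 ≤ m + 1 + 1 by omega), coeff_mk, show m + 1 + 1 - 2 = m by omega,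
      if_neg (show m + 1 + 1 ≠ 0 by omega)]
    by_cases hm : 2 ∣ m
    · rw [if_pos hm, if_pos (by omega), sub_self]
    · rw [if_neg hm, if_neg (by omega), sub_self]

/-- Pascal's rule in generating functions: `(1 − z²)·∑_j C(j+d+1, d+1)z^{2j} = ∑_j C(j+d, d)z^{2j}`. [folklore] -/
private theorem one_sub_X_sq_mul_mk_even_choose_succ (R : Type*) [CommRing R] (d : ℕ) :
    ((1 : R⟦X⟧) - X ^ 2) * PowerSeries.mk (fun m ↦ if 2 ∣ m then (((m / 2 + (d + 1)).choose (d + 1) : ℕ) : R) else 0) =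
      PowerSeries.mk (fun m ↦ if 2 ∣ m then (((m / 2 + d).choose d : ℕ) : R) else 0) := by
  ext m
  rw [sub_mul, one_mul, map_sub, coeff_X_pow_mul', coeff_mk, coeff_mk]
  rcases m with _ | _ | m
  · simp
  · norm_num
  · rw [if_pos (show 2 ≤ m + 1 + 1 by omega), coeff_mk, show m + 1 + 1 - 2 = m by omega]
    by_cases hm : 2 ∣ m
    · rw [if_pos hm, if_pos (by omega), if_pos (by omega), show (m + 1 + 1) / 2 = m / 2 + 1 by omega,
        show m / 2 + 1 + (d + 1) = (m / 2 + (d + 1)) + 1 by ring, Nat.choose_succ_succ' (m / 2 + (d + 1)) d,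
        show m / 2 + 1 + d = m / 2 + (d + 1) by ring]
      push_cast
      ring
    · rw [if_neg hm, if_neg (by omega), if_neg (by omega), sub_zero]

/-- **`(1 − z²)^{d+1}·∑_j C(j+d, d)z^{2j} = 1`**: `∑_j C(j+d, d)z^{2j} = (1 − z²)^{−(d+1)}` is the generating function of `#{r ∈
ℕ^{d+1} : ∑rᵢ = j}` in the variable `z²` (the survey's expansion `(1 − z²)^{−(n−1)} = ∑_{r≥0} C(r+n−2, n−2)z^{2r}`). [cite:
LauretMiatelloRossetti2019, §3 (the expansion of `(1 − z²)^{−(n−1)}` after Theorem 3.1)] -/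
theorem one_sub_X_sq_pow_mul_mk_even_choose (R : Type*) [CommRing R] (d : ℕ) :
    ((1 : R⟦X⟧) - X ^ 2) ^ (d + 1) * PowerSeries.mk (fun m ↦ if 2 ∣ m then (((m / 2 + d).choose d : ℕ) : R) else 0) = 1 := by
  induction d with
  | zero =>
    simp_rw [Nat.choose_zero_right, Nat.cast_one, zero_add, pow_one]
    exact one_sub_X_sq_mul_mk_even_one R
  | succ d ih =>
    rw [pow_succ, mul_assoc, one_sub_X_sq_mul_mk_even_choose_succ, ih]

/-- **`∑_k dim 𝓟_k^Γ z^k = (∑_j C(j+d, d)z^{2j})·Θ_𝓛(z)`** (`= Θ_𝓛(z)/(1 − z²)^{d+1}`) for `L(q; p₀, …, p_d)`, in `R⟦z⟧` for any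
commutative ring `R`. [cite: LauretMiatelloRossetti2015, Lemma 3.6 and Theorem 3.8 (proof); LauretMiatelloRossetti2019, §3 (Theorem 3.1 and the
multiplicity formula after it)] -/
theorem mk_lensSpaceMonomialCount_eq_mul (R : Type*) [CommRing R] (q : ℕ) {d : ℕ} (p : Fin (d + 1) → ℤ) :
    PowerSeries.mk (fun k ↦ (lensSpaceMonomialCount q p k : R)) =
      PowerSeries.mk (fun m ↦ if 2 ∣ m then (((m / 2 + d).choose d : ℕ) : R) else 0) *
        PowerSeries.mk (fun k ↦ (((Fintype.piFinset fun _ : Fin (d + 1) ↦ Finset.Icc (-(k : ℤ)) (k : ℤ)).filter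
          (fun μ ↦ ∑ i, (μ i).natAbs = k ∧ (q : ℤ) ∣ ∑ i, μ i * p i)).card : R)) := by
  ext k
  rw [coeff_mk, coeff_mk_even_mul_mk (fun j ↦ (((j + d).choose d : ℕ) : R)) _ k, lensSpaceMonomialCount_eq_sum_choose_mul]
  simp only [Nat.cast_sum, Nat.cast_mul]

/-- **`(1 − z²)^{d+1}·∑_k dim 𝓟_k^Γ z^k = Θ_𝓛(z)`** for `L(q; p₀, …, p_d)` (the survey's computation before Theorem 3.1, with `(1 − z²)^n`:
`(1/q)∑_l ∏ᵢ(1 − z²)/((1 − ξ^{lsᵢ}z)(1 − ξ^{−lsᵢ}z)) = ∑_{μ ∈ 𝓛} z^{‖μ‖₁}`), in `R⟦z⟧`. [cite: LauretMiatelloRossetti2019, §3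
(the computation before Theorem 3.1); LauretMiatelloRossetti2015, Lemma 3.6] -/
theorem one_sub_X_sq_pow_mul_mk_lensSpaceMonomialCount (R : Type*) [CommRing R] (q : ℕ) {d : ℕ} (p : Fin (d + 1) → ℤ) :
    ((1 : R⟦X⟧) - X ^ 2) ^ (d + 1) * PowerSeries.mk (fun k ↦ (lensSpaceMonomialCount q p k : R)) =
      PowerSeries.mk (fun k ↦ (((Fintype.piFinset fun _ : Fin (d + 1) ↦ Finset.Icc (-(k : ℤ)) (k : ℤ)).filter
        (fun μ ↦ ∑ i, (μ i).natAbs = k ∧ (q : ℤ) ∣ ∑ i, μ i * p i)).card : R)) := by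
  rw [mk_lensSpaceMonomialCount_eq_mul, ← mul_assoc, one_sub_X_sq_pow_mul_mk_even_choose, one_mul]

/-- `F_L(z) = ∑_k dim 𝓗_k^Γ z^k = (1 − z²)·∑_k dim 𝓟_k^Γ z^k` ("`𝓟_k ≃ 𝓗_k ⊕ 𝓟_{k−2}` … thus `m_{π_{kε₁}}(μ) = m_{𝓟_k}(μ) −
m_{𝓟_{k−2}}(μ)`"), in `R⟦z⟧`. [cite: LauretMiatelloRossetti2015, proof of Lemma 3.6; IkedaYamamoto1979, Proposition 2.1
and §3 (3.1)] -/
theorem mk_lensSpaceMultiplicity_eq_one_sub_X_sq_mul (R : Type*) [CommRing R] (q : ℕ) {d : ℕ} (p : Fin (d + 1) → ℤ) :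
    PowerSeries.mk (fun k ↦ (lensSpaceMultiplicity q p k : R)) =
      ((1 : R⟦X⟧) - X ^ 2) * PowerSeries.mk (fun k ↦ (lensSpaceMonomialCount q p k : R)) := by
  ext k
  rw [coeff_mk, sub_mul, one_mul, map_sub, coeff_X_pow_mul', coeff_mk]
  rcases k with _ | _ | k
  · simp [lensSpaceMultiplicity]
  · simp [lensSpaceMultiplicity]
  · rw [lensSpaceMultiplicity_add_two, Nat.cast_sub (lensSpaceMonomialCount_le_add_two q p k), if_pos (by omega), coeff_mk,
      show k + 1 + 1 - 2 = k by omega]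

/-- **THEOREM 3.1 (Lauret–Miatello–Rossetti) IN EVERY DIMENSION: `(1 − z²)^d·F_L(z) = Θ_𝓛(z)`**, i.e. `F_L(z) = Θ_𝓛(z)/(1 −
z²)^{n−1}` for the lens space / lens orbifold `L = L(q; p₀, …, p_d) = S^{2d+1}/G` (`n = d + 1` weights), where `F_L(z) = ∑_k dim
E_{k(k+2d)}z^k` (`dim E_{k(k+2d)} = lensSpaceMultiplicity q p k`) and `Θ_𝓛(z) = ∑_k N_𝓛(k)z^k`, `N_𝓛(k) = #{μ ∈ ℤ^{d+1} : ∑|μᵢ| = k,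
q ∣ ∑μᵢpᵢ}` ("If `L` is a lens orbifold and `𝓛` its associated congruence lattice, then we have that `F_L(z) = Θ_𝓛(z)/(1 − z²)^{n−1}`");
in `R⟦z⟧` for any commutative ring `R`, every `q : ℕ` and every weight family. [cite: LauretMiatelloRossetti2019, Theorem 3.1;
LauretMiatelloRossetti2015, Theorem 3.8] -/
theorem one_sub_X_sq_pow_mul_mk_lensSpaceMultiplicity (R : Type*) [CommRing R] (q : ℕ) {d : ℕ} (p : Fin (d + 1) → ℤ) :
    ((1 : R⟦X⟧) - X ^ 2) ^ d * PowerSeries.mk (fun k ↦ (lensSpaceMultiplicity q p k : R)) =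
      PowerSeries.mk (fun k ↦ (((Fintype.piFinset fun _ : Fin (d + 1) ↦ Finset.Icc (-(k : ℤ)) (k : ℤ)).filter
        (fun μ ↦ ∑ i, (μ i).natAbs = k ∧ (q : ℤ) ∣ ∑ i, μ i * p i)).card : R)) := by
  rw [mk_lensSpaceMultiplicity_eq_one_sub_X_sq_mul, ← mul_assoc, ← pow_succ, one_sub_X_sq_pow_mul_mk_lensSpaceMonomialCount]

/-- **THEOREM 3.8 (`p = 0`) / THE MULTIPLICITY FORMULA IN EVERY DIMENSION: `dim E_{k(k+2n−2)}(L) = ∑_{j=0}^{⌊k/2⌋}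
C(j+n−2, n−2)·N_𝓛(k − 2j)`** for `L = L(q; p₀, …, p_{d+1}) = S^{2d+3}/G` (`n = d + 2 ≥ 2` weights, `C(j+n−2, n−2) = C(j+d, d)`;
"the multiplicity of `λ_k = k(k+2n−2)` in `Spec(L)` is given by `dim 𝓗_k^Γ = ∑_{r=0}^{⌊k/2⌋} C(r+n−2, n−2)N_𝓛(k−2r)`"; from
`F_L = (1 − z²)·Θ_𝓛/(1 − z²)^{d+2} = Θ_𝓛·∑_j C(j+d, d)z^{2j}`). [cite: LauretMiatelloRossetti2015, Theorem 3.8 (`p = 0`);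
LauretMiatelloRossetti2019, §3 (the multiplicity formula after Theorem 3.1)] -/
theorem lensSpaceMultiplicity_eq_sum_choose_mul (q : ℕ) {d : ℕ} (p : Fin (d + 2) → ℤ) (k : ℕ) :
    lensSpaceMultiplicity q p k = ∑ j ∈ range (k / 2 + 1), (j + d).choose d *
      ((Fintype.piFinset fun _ : Fin (d + 2) ↦ Finset.Icc (-((k - 2 * j : ℕ) : ℤ)) ((k - 2 * j : ℕ) : ℤ)).filter
        (fun μ ↦ ∑ i, (μ i).natAbs = k - 2 * j ∧ (q : ℤ) ∣ ∑ i, μ i * p i)).card := by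
  have h := mk_lensSpaceMultiplicity_eq_one_sub_X_sq_mul ℤ q p
  rw [mk_lensSpaceMonomialCount_eq_mul, ← mul_assoc, one_sub_X_sq_mul_mk_even_choose_succ] at h
  have hk := congrArg (coeff k) h
  rw [coeff_mk, coeff_mk_even_mul_mk (fun j ↦ (((j + d).choose d : ℕ) : ℤ)) _ k] at hk
  exact_mod_cast hk

/-- One weight (`d = 0`, the circle `S¹/G`, `G` acting by `γ^{p₀}`): `dim 𝓗_k^Γ = N_𝓛(k)` (`(1 − z²)^0·F_L = Θ_𝓛`; for `k ≥ 1` both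
sides count the two exponentials `z^k`, `z̄^k` = the two lattice points `±k` that are invariant). [cite: LauretMiatelloRossetti2019,
Theorem 3.1 (`n = 1`)] -/
theorem lensSpaceMultiplicity_fin_one (q : ℕ) (p : Fin 1 → ℤ) (k : ℕ) :
    lensSpaceMultiplicity q p k = ((Fintype.piFinset fun _ : Fin 1 ↦ Finset.Icc (-(k : ℤ)) (k : ℤ)).filter
        (fun μ ↦ ∑ i, (μ i).natAbs = k ∧ (q : ℤ) ∣ ∑ i, μ i * p i)).card := by
  have h := congrArg (coeff k) (one_sub_X_sq_pow_mul_mk_lensSpaceMultiplicity ℤ q p)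
  rw [pow_zero, one_mul, coeff_mk, coeff_mk] at h
  exact_mod_cast h

/-! ### §3 THEOREM 3.9 (i) / 3.2: isospectral iff the congruence lattices are `‖·‖₁`-isospectral -/

/-- `1 − z²` is not a zero divisor: it is nonzero in the domain `ℤ⟦z⟧`. [folklore] -/
private theorem one_sub_X_sq_ne_zero_int : ((1 : ℤ⟦X⟧) - X ^ 2) ≠ 0 := by
  intro h
  have := congrArg (coeff 0) h
  simp at this

/-- **THEOREM 3.9 (i) (= Theorem 3.6 (i) of the printed version; the survey's THEOREM 3.2) (Lauret–Miatello–Rossetti), EVERY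
DIMENSION: "`L` and `L'` are `0`-isospectral if and only if `𝓛` and `𝓛'` are `‖·‖₁`-isospectral"** — for `L = L(q; p₀, …, p_d)` and
`L' = L(q'; p'₀, …, p'_d)` of the same dimension `2d + 1`: `dim E_{k(k+2d)}(L) = dim E_{k(k+2d)}(L')` for all `k` iff `N_𝓛(k) =
N_𝓛'(k)` for all `k` (`Θ_𝓛 = Θ_𝓛'`). Proof: both sides say `(1 − z²)^d·F_L = (1 − z²)^d·F_{L'}` in the domain `ℤ⟦z⟧` (Theorem 3.1),
which is the printed induction on `k` ("All the terms with `r > 0` on both sides are equal by assumption, hence … `N_𝓛(k₀) =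
N_𝓛'(k₀)`"). [cite: LauretMiatelloRossetti2015, Theorem 3.9 (i); LauretMiatelloRossetti2019, Theorem 3.2] -/
theorem lensSpaceMultiplicity_eq_iff_card_oneNorm_congruenceLattice_eq (q q' : ℕ) {d : ℕ} (p p' : Fin (d + 1) → ℤ) :
    (∀ k : ℕ, lensSpaceMultiplicity q p k = lensSpaceMultiplicity q' p' k) ↔
      ∀ k : ℕ, ((Fintype.piFinset fun _ : Fin (d + 1) ↦ Finset.Icc (-(k : ℤ)) (k : ℤ)).filter
          (fun μ ↦ ∑ i, (μ i).natAbs = k ∧ (q : ℤ) ∣ ∑ i, μ i * p i)).card =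
        ((Fintype.piFinset fun _ : Fin (d + 1) ↦ Finset.Icc (-(k : ℤ)) (k : ℤ)).filter
          (fun μ ↦ ∑ i, (μ i).natAbs = k ∧ (q' : ℤ) ∣ ∑ i, μ i * p' i)).card := by
  constructor
  · intro h k
    have h1 := one_sub_X_sq_pow_mul_mk_lensSpaceMultiplicity ℤ q p
    have h2 := one_sub_X_sq_pow_mul_mk_lensSpaceMultiplicity ℤ q' p'
    have e : PowerSeries.mk (fun k ↦ (lensSpaceMultiplicity q p k : ℤ)) =
        PowerSeries.mk (fun k ↦ (lensSpaceMultiplicity q' p' k : ℤ)) := by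
      ext k
      rw [coeff_mk, coeff_mk, h k]
    rw [e, h2] at h1
    have hk := congrArg (coeff k) h1
    simp only [coeff_mk, Nat.cast_inj] at hk
    exact hk.symm
  · intro h k
    have h1 := one_sub_X_sq_pow_mul_mk_lensSpaceMultiplicity ℤ q p
    have h2 := one_sub_X_sq_pow_mul_mk_lensSpaceMultiplicity ℤ q' p'
    have e : ((1 : ℤ⟦X⟧) - X ^ 2) ^ d * PowerSeries.mk (fun k ↦ (lensSpaceMultiplicity q p k : ℤ)) =
        ((1 : ℤ⟦X⟧) - X ^ 2) ^ d * PowerSeries.mk (fun k ↦ (lensSpaceMultiplicity q' p' k : ℤ)) := by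
      rw [h1, h2]
      ext k
      rw [coeff_mk, coeff_mk, h k]
    have hk := congrArg (coeff k) (mul_left_cancel₀ (pow_ne_zero d one_sub_X_sq_ne_zero_int) e)
    simp only [coeff_mk, Nat.cast_inj] at hk
    exact hk

/-! ### §4 The survey's road in `ℝ⟦z⟧`: `∑_{l<q}(1 − z²)^n/∏ᵢ(1 − ξ^{lpᵢ}z)(1 − ξ^{−lpᵢ}z) = q·Θ_𝓛(z)` -/

/-- **The survey's computation before Theorem 3.1, in `ℝ⟦z⟧`**: `∑_{l=0}^{q−1} (1 − z²)^{d+1}·∏ᵢ(1 − 2cos(2πlpᵢ/q)z + z²)^{−1} = q·Θ_𝓛(z)` for `L(q;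
p₀, …, p_d)`, `q ≥ 1` (`(1 − ξ^{lp}z)(1 − ξ^{−lp}z) = 1 − 2cos(2πlp/q)z + z²`; "`F_L(z) = (1/(1 − z²)^{n−1})(1/q)∑_l ∏_j (1 −
z²)/((1 − ξ^{ls_j}z)(1 − ξ^{−ls_j}z)) = ⋯ = (1/(1 − z²)^{n−1})∑_{(a₁,…,a_n) ∈ ℤⁿ : q ∣ a₁s₁+⋯+a_ns_n} z^{‖(a₁,…,a_n)‖₁}`"), from
Ikeda's generating function `mk_lensSpaceMultiplicity` and Theorem 3.1. [cite: LauretMiatelloRossetti2019, §3 (the computation before Theorem 3.1) and Theorem 3.1] -/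
theorem sum_range_one_sub_X_sq_pow_mul_inv_prod_quadratic (q : ℕ) (hq : q ≠ 0) {d : ℕ} (p : Fin (d + 1) → ℤ) :
    ∑ l ∈ range q, ((1 : ℝ⟦X⟧) - X ^ 2) ^ (d + 1) *
        (∏ i, ((1 : ℝ⟦X⟧) - PowerSeries.C (2 * Real.cos (2 * Real.pi * l * p i / q)) * X + X ^ 2))⁻¹ =
      (q : ℝ) • PowerSeries.mk (fun k ↦ (((Fintype.piFinset fun _ : Fin (d + 1) ↦ Finset.Icc (-(k : ℤ)) (k : ℤ)).filter
        (fun μ ↦ ∑ i, (μ i).natAbs = k ∧ (q : ℤ) ∣ ∑ i, μ i * p i)).card : ℝ)) := by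
  have hq' : (q : ℝ) ≠ 0 := Nat.cast_ne_zero.mpr hq
  have h := one_sub_X_sq_pow_mul_mk_lensSpaceMultiplicity ℝ q p
  rw [mk_lensSpaceMultiplicity q hq p, mul_smul_comm, Finset.mul_sum] at h
  rw [← h, smul_smul, mul_one_div_cancel hq', one_smul]
  refine Finset.sum_congr rfl fun l _ ↦ ?_
  rw [← mul_assoc, ← pow_succ]

/-! ### §5 Values: `N_𝓛(0) = 1`, `N_𝓛(1) = 0` for a lens space, and `q = 1`: the one-norm spheres of `ℤ^{d+1}` -/

/-- `N_𝓛(0) = 1` (the origin; "The case `k = 0` is clear, since both sides are equal to one"). [cite: LauretMiatelloRossetti2015,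
proof of Theorem 3.9 (i)] -/
theorem card_oneNorm_congruenceLattice_zero (q : ℕ) {n : ℕ} (p : Fin n → ℤ) :
    ((Fintype.piFinset fun _ : Fin n ↦ Finset.Icc (-((0 : ℕ) : ℤ)) ((0 : ℕ) : ℤ)).filter
        (fun μ ↦ ∑ i, (μ i).natAbs = 0 ∧ (q : ℤ) ∣ ∑ i, μ i * p i)).card = 1 := by
  classical
  rw [Finset.card_eq_one]
  refine ⟨0, Finset.eq_singleton_iff_unique_mem.mpr ⟨?_, fun μ hμ ↦ ?_⟩⟩
  · exact Finset.mem_filter.mpr ⟨Fintype.mem_piFinset.mpr fun i ↦ by simp, by simp, by simp⟩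
  · simp only [Finset.mem_filter, Fintype.mem_piFinset, Finset.mem_Icc] at hμ
    funext i
    have := hμ.1 i
    simp only [Pi.zero_apply]
    omega

/-- `N_𝓛(1) = 0` for a lens SPACE (`pᵢ ≢ 0 (mod q)` for all `i`: the `2n` lattice points `±eᵢ` of one-norm `1` are not in `𝓛`),
matching `dim E_{2n−1} = 0` (no invariant linear forms). [cite: LauretMiatelloRossetti2015, Definition 3.2 (each `s_j` coprime to `q`)] -/
theorem card_oneNorm_congruenceLattice_one {q : ℕ} {n : ℕ} {p : Fin n → ℤ} (hp : ∀ i, ¬(q : ℤ) ∣ p i) :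
    ((Fintype.piFinset fun _ : Fin n ↦ Finset.Icc (-((1 : ℕ) : ℤ)) ((1 : ℕ) : ℤ)).filter
        (fun μ ↦ ∑ i, (μ i).natAbs = 1 ∧ (q : ℤ) ∣ ∑ i, μ i * p i)).card = 0 := by
  classical
  rw [Finset.card_eq_zero, Finset.filter_eq_empty_iff]
  rintro μ - ⟨hsum, hdvd⟩
  -- `∑|μᵢ| = 1`: exactly one coordinate `i₀` has `|μ_{i₀}| = 1`, the others vanish
  have hne : ∑ i, (μ i).natAbs ≠ 0 := by
    rw [hsum]
    exact one_ne_zero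
  obtain ⟨i₀, -, hi₀⟩ := Finset.exists_ne_zero_of_sum_ne_zero hne
  have hrest : ∀ i, i ≠ i₀ → μ i = 0 := by
    intro i hi
    have h2 : (μ i₀).natAbs + (μ i).natAbs ≤ ∑ j, (μ j).natAbs := by
      rw [← Finset.sum_pair (f := fun j ↦ (μ j).natAbs) (Ne.symm hi)]
      exact Finset.sum_le_sum_of_subset_of_nonneg (Finset.subset_univ _) fun j _ _ ↦ Nat.zero_le _
    have : (μ i).natAbs = 0 := by omega
    exact Int.natAbs_eq_zero.mp this
  have h1 : (μ i₀).natAbs = 1 := by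
    have hle : (μ i₀).natAbs ≤ ∑ j, (μ j).natAbs :=
      Finset.single_le_sum (f := fun j ↦ (μ j).natAbs) (fun j _ ↦ Nat.zero_le _) (Finset.mem_univ i₀)
    omega
  rw [Finset.sum_eq_single i₀ (fun i _ hi ↦ by rw [hrest i hi, zero_mul]) (fun h ↦ absurd (Finset.mem_univ i₀) h)] at hdvd
  rcases Int.natAbs_eq_iff.mp h1 with h | h
  · rw [h] at hdvd
    exact hp i₀ (by simpa using hdvd)
  · rw [h] at hdvd
    exact hp i₀ (by simpa using hdvd)

/-- **`q = 1`, the one-norm spheres of `ℤ^{d+1}`: `Θ_{ℤ^{d+1}}(z)·(1 − z)^{d+1} = (1 + z)^{d+1}`**, i.e. `∑_k #{μ ∈ ℤ^{d+1} : ‖μ‖₁ =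
k}z^k = ((1 + z)/(1 − z))^{d+1}` — Theorem 3.1's identity `(1 − z²)^{d+1}·∑_k dim 𝓟_k z^k = Θ` for the trivial group together with
`dim 𝓟_k(ℂ^{d+1}) = C(k+2d+1, 2d+1)` (`∑_k dim 𝓟_k z^k = (1 − z)^{−(2d+2)}`, row g44-#2's `lensSpaceMonomialCount_one_left`), in `R⟦z⟧`.
[cite: LauretMiatelloRossetti2019, Theorem 3.1 (the case `q = 1`: `𝓛 = ℤⁿ`, `L = S^{2n−1}`)] -/
theorem mk_card_oneNorm_int_mul_one_sub_X_pow (R : Type*) [CommRing R] {d : ℕ} (p : Fin (d + 1) → ℤ) :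
    PowerSeries.mk (fun k ↦ (((Fintype.piFinset fun _ : Fin (d + 1) ↦ Finset.Icc (-(k : ℤ)) (k : ℤ)).filter
        (fun μ ↦ ∑ i, (μ i).natAbs = k ∧ ((1 : ℕ) : ℤ) ∣ ∑ i, μ i * p i)).card : R)) * ((1 : R⟦X⟧) - X) ^ (d + 1) =
      ((1 : R⟦X⟧) + X) ^ (d + 1) := by
  have hP : PowerSeries.mk (fun k ↦ (lensSpaceMonomialCount 1 p k : R)) = (PowerSeries.mk 1) ^ ((2 * d + 1) + 1) := by
    rw [mk_one_pow_eq_mk_choose_add]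
    ext k
    rw [coeff_mk, coeff_mk, lensSpaceMonomialCount_one_left, show 2 * d + 1 + k = k + 2 * d + 1 by ring]
  have h1 : (PowerSeries.mk 1 : R⟦X⟧) * (1 - X) = 1 := mk_one_mul_one_sub_eq_one R
  have key : (PowerSeries.mk 1 : R⟦X⟧) ^ (d + 1) * (1 - X) ^ (d + 1) = 1 := by
    rw [← mul_pow, h1, one_pow]
  rw [← one_sub_X_sq_pow_mul_mk_lensSpaceMonomialCount R 1 p, hP]
  calc ((1 : R⟦X⟧) - X ^ 2) ^ (d + 1) * PowerSeries.mk 1 ^ ((2 * d + 1) + 1) * (1 - X) ^ (d + 1)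
      = (1 + X) ^ (d + 1) * ((PowerSeries.mk 1 ^ (d + 1) * (1 - X) ^ (d + 1)) *
          (PowerSeries.mk 1 ^ (d + 1) * (1 - X) ^ (d + 1))) := by
        rw [show (2 * d + 1) + 1 = (d + 1) + (d + 1) by ring, pow_add,
          show ((1 : R⟦X⟧) - X ^ 2) = (1 + X) * (1 - X) by ring, mul_pow]
        ring
    _ = (1 + X) ^ (d + 1) := by rw [key, mul_one, mul_one]

end Literature.Analysis.InnerProduct
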